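import Literature.Analysis.FluidPDE.DriftMildBootstrap
import Literature.Analysis.UnboundedOperators.HeatIteratedDerivBounds
import HarnessLib

/-!
# Hölder gain of the forward Duhamel integrals of the heat equation, from the initial time

Analysis/FluidPDE support file (everything proved; no named facts) on the proof path of the named
fact `Literature.Analysis.FluidPDE.jia_sverak_2014_local_higher_regularity`
(`JiaSverak2014LocalRegularity.lean`; H. Jia, V. Šverák, Invent. Math. 196 (2014) =
arXiv:1204.0529, §4, proof of Thm. 4.1: all spatial derivatives of a Leray solution are bounded
up to the initial time near a point where the datum is smooth, "by Theorem 3.1 and some simple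
bootstrapping arguments"; the one printed bootstrap, proof of Thm. 3.2, arXiv p. 9, decomposes the
localised velocity as `u = u₁ + u₂ + u₃` with
`u₁ = ∫₀ᵗ e^{Δ(t-s)}[-div(u ⊗ u η) - ∇(pη)] ds`, `u₂ = e^{Δt}(u₀η)` and uses the Hölder estimates
for heat potentials of its Lemma 3.3). The route taken in the tree writes the localised velocity
`W = ζu` through the **forced-heat mild identity from the initial time**

  `W(t) = e^{tΔ}W(0) + ∫₀ᵗ e^{(t-τ)Δ}F₀(τ) dτ + Σⱼ ∫₀ᵗ ∂ⱼe^{(t-τ)Δ}F₁ʲ(τ) dτ`,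

and the all-orders bootstrap needs exactly three facts about the right-hand side, in the
single-constant Hölder classes `IsHolderField k α A` of `OseenSliceHolder.lean`; they are proved
here, in any finite-dimensional real inner product space `E` and for fields with values in a real
Banach space `F`:

* `IsHolderField.heatExtension` — **the free flow preserves `C^{k,α}` with the same constant**
  (the kernel is a probability density and derivatives fall on the data,
  `UnboundedOperators.iteratedFDeriv_heatExtension_of_bounded`): no loss at `t = 0` when the datum
  is smooth, which is what distinguishes this bootstrap from the interior one of
  `DriftMildBootstrap.lean` (restart at `t - δ/2`);
* `exists_holder_gain_heatExtension` — **Hölder data gain derivatives under the heat flow**: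
  for `a ∈ C^{k,α}` with constant `A`, `‖Dᵏ⁺¹e^{σΔ}a‖ ≤ Cσ^{-1/2+α/2}A`,
  `‖Dᵏ⁺²e^{σΔ}a‖ ≤ Cσ^{-1+α/2}A`, `‖Dᵏ⁺³e^{σΔ}a‖ ≤ Cσ^{-3/2+α/2}A` (semigroup splitting
  `σ = σ/2 + σ/4 + σ/4`, the Hölder gradient gain of `HeatKernelBoundedData` on `Dᵏa`, and the
  bounded-data gradient gain of `HeatIteratedDerivBounds` twice);
* `exists_heatDuhamel_holder_step`, `exists_heatGradDuhamel_holder_step` — **the Duhamel terms of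
  `L^∞_t C^{k,1/2}_x` data are `C^{k+1,1/2}` uniformly up to the initial time**: for jointly
  measurable `g` with `g(τ) ∈ C^{k,1/2}` (constant `A`) for `τ ∈ (s, t)`, `t ≤ s + 1`, the forward
  integrals `heatDuhamel s g t = ∫ₛᵗ e^{(t-τ)Δ}g(τ) dτ` and
  `heatGradDuhamel s g v t = ∫ₛᵗ ∂ᵥe^{(t-τ)Δ}g(τ) dτ` (`‖v‖ ≤ 1`) are `C^{k+1,1/2}` fields with
  constant `C A`, `C = C(k, E)` (dominated differentiation under the time integral,
  `FunctionSpaces.contDiff_integral_of_dominated_iteratedFDeriv`, with the integrable weights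
  `(t-τ)^{-1/2}`, `(t-τ)^{-3/4}` and, for the Hölder modulus of the top derivative of the gradient
  term, the lossless splitting `∫ min(2σ^{-3/4}, rσ^{-5/4}) ≤ 12 r^{1/2}` of
  `DriftMildBootstrap.lean`).

This is the classical Hölder-space potential theory of the heat equation in the elementary
semigroup form (Ladyzhenskaya–Solonnikov–Ural'tseva 1968, Ch. IV §§1–2; the estimates are those
behind Jia–Šverák's Lemma 3.3), specialised to what the Navier–Stokes bootstrap consumes.

## References

* H. Jia, V. Šverák, Invent. Math. 196 (2014) 233–265 = arXiv:1204.0529, §3 Lemma 3.3 and proof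
  of Thm. 3.2 (p. 9), §4 proof of Thm. 4.1. [JiaSverak2014]
* O. A. Ladyzhenskaya, V. A. Solonnikov, N. N. Ural'tseva, *Linear and quasi-linear equations of
  parabolic type*, AMS (1968), Ch. IV §§1–2.
* G. Koch, N. Nadirashvili, G. Seregin, V. Šverák, Acta Math. 203 (2009) = arXiv:0709.3599, §4
  (the same bootstrap in Oseen form, `DriftMildBootstrap.lean`). [KochNadirashviliSereginSverak2009]
-/

noncomputable section

open MeasureTheory Set Function Filter Metric Real
open _root_.Topology
open scoped ENNReal NNReal ContDiff

namespace Literature.Analysis.FluidPDE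

open UnboundedOperators (heatKernel heatExtension)
open FunctionSpaces (contDiff_integral_of_dominated_iteratedFDeriv norm_iteratedFDeriv_integral_le
  norm_iteratedFDeriv_integral_sub_le stronglyMeasurable_iteratedFDeriv_param
  stronglyMeasurable_fderiv_apply_param)

variable {E : Type*} [NormedAddCommGroup E] [InnerProductSpace ℝ E] [FiniteDimensional ℝ E]
  [MeasurableSpace E] [BorelSpace E]
variable {F : Type*} [NormedAddCommGroup F] [NormedSpace ℝ F] [CompleteSpace F]

/-! ### Algebra of single-constant Hölder fields -/

section Algebra

omit [InnerProductSpace ℝ E] [FiniteDimensional ℝ E] [MeasurableSpace E] [BorelSpace E]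
  [CompleteSpace F]
variable [NormedSpace ℝ E] {k : ℕ} {α A B : ℝ} {a b : E → F}

/-- Enlarging the constant of a `C^{k,α}` field. [folklore] -/
theorem IsHolderField.mono_const (h : IsHolderField k α A a) (hAB : A ≤ B) :
    IsHolderField k α B a :=
  ⟨h.contDiff, fun j hj x => (h.norm_le j hj x).trans hAB, fun x y =>
    (h.holder x y).trans (mul_le_mul_of_nonneg_right hAB (Real.rpow_nonneg (norm_nonneg _) _))⟩

/-- **Sums of `C^{k,α}` fields**: constants add. [folklore] -/
theorem IsHolderField.add (ha : IsHolderField k α A a) (hb : IsHolderField k α B b) :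
    IsHolderField k α (A + B) (a + b) := by
  have hder : ∀ j ≤ k, ∀ x, iteratedFDeriv ℝ j (a + b) x =
      iteratedFDeriv ℝ j a x + iteratedFDeriv ℝ j b x := fun j hj x =>
    iteratedFDeriv_add_apply (ha.contDiff.of_le (by exact_mod_cast hj)).contDiffAt
      (hb.contDiff.of_le (by exact_mod_cast hj)).contDiffAt
  refine ⟨ha.contDiff.add hb.contDiff, fun j hj x => ?_, fun x y => ?_⟩
  · rw [hder j hj x]
    exact (norm_add_le _ _).trans (add_le_add (ha.norm_le j hj x) (hb.norm_le j hj x))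
  · rw [hder k le_rfl x, hder k le_rfl y, add_sub_add_comm]
    refine (norm_add_le _ _).trans ?_
    rw [add_mul]
    exact add_le_add (ha.holder x y) (hb.holder x y)

/-- Negation of a `C^{k,α}` field. [folklore] -/
theorem IsHolderField.neg (ha : IsHolderField k α A a) : IsHolderField k α A (-a) := by
  have hder : ∀ j x, iteratedFDeriv ℝ j (-a) x = -iteratedFDeriv ℝ j a x := fun j x =>
    iteratedFDeriv_neg_apply
  refine ⟨ha.contDiff.neg, fun j hj x => ?_, fun x y => ?_⟩
  · rw [hder, norm_neg]; exact ha.norm_le j hj x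
  · rw [hder, hder, ← neg_sub', norm_neg, ← neg_sub, norm_neg, norm_sub_rev]; exact ha.holder x y

/-- Differences of `C^{k,α}` fields. [folklore] -/
theorem IsHolderField.sub (ha : IsHolderField k α A a) (hb : IsHolderField k α B b) :
    IsHolderField k α (A + B) (a - b) := by
  rw [sub_eq_add_neg]; exact ha.add hb.neg

/-- The zero field is `C^{k,α}` with constant `0`. [folklore] -/
theorem isHolderField_zero (k : ℕ) (α : ℝ) : IsHolderField k α 0 (0 : E → F) := by
  refine ⟨contDiff_const, fun j hj x => ?_, fun x y => ?_⟩
  · rw [iteratedFDeriv_zero]; simp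
  · rw [iteratedFDeriv_zero]; simp

/-- **Finite sums of `C^{k,α}` fields**: constants add. [folklore] -/
theorem IsHolderField.sum {ι : Type*} (s : Finset ι) {As : ι → ℝ} {as : ι → E → F}
    (h : ∀ i ∈ s, IsHolderField k α (As i) (as i)) :
    IsHolderField k α (∑ i ∈ s, As i) (∑ i ∈ s, as i) := by
  classical
  induction s using Finset.induction_on with
  | empty => simpa using isHolderField_zero (E := E) (F := F) k α
  | insert i s hi ih =>
    rw [Finset.sum_insert hi, Finset.sum_insert hi]
    exact (h i (Finset.mem_insert_self i s)).add (ih fun j hj => h j (Finset.mem_insert_of_mem hj))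

/-- **The top derivative of a `C^{k,α}` field is a `C^{0,α}` field** (with values in multilinear
maps) with the same constant. [folklore] -/
theorem IsHolderField.iteratedFDeriv_top (ha : IsHolderField k α A a) :
    IsHolderField 0 α A (iteratedFDeriv ℝ k a) := by
  refine ⟨contDiff_zero.2 (ha.contDiff.continuous_iteratedFDeriv le_rfl), fun j hj x => ?_,
    fun x y => ?_⟩
  · obtain rfl := Nat.le_zero.1 hj
    rw [norm_iteratedFDeriv_zero]; exact ha.norm_le k le_rfl x
  · rw [iteratedFDeriv_zero_eq_comp, Function.comp_apply, Function.comp_apply, ← map_sub,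
      LinearIsometryEquiv.norm_map]
    exact ha.holder x y

end Algebra

/-! ### The free heat flow on Hölder fields -/

section Heat

variable {k : ℕ} {α A : ℝ} {a : E → F}

omit [CompleteSpace F] in
/-- A bounded continuous field is in `L^∞` (the form consumed by the semigroup law). [folklore] -/
theorem IsHolderField.memLp_top (ha : IsHolderField k α A a) : MemLp a ∞ (volume : Measure E) :=
  UnboundedOperators.memLp_top_of_continuous_of_bound ha.continuous ha.norm_apply_le

/-- **Derivatives fall on the data** for a `C^{k,α}` field: `Dʲ(e^{tΔ}a) = e^{tΔ}(Dʲa)` for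
`j ≤ k`, `0 < t`. [folklore] -/
theorem IsHolderField.iteratedFDeriv_heatExtension (ha : IsHolderField k α A a) {t : ℝ}
    (ht : 0 < t) {j : ℕ} (hj : j ≤ k) :
    iteratedFDeriv ℝ j (heatExtension a t) = heatExtension (iteratedFDeriv ℝ j a) t :=
  UnboundedOperators.iteratedFDeriv_heatExtension_of_bounded ha.contDiff (C := fun _ => A)
    (fun j hj z => ha.norm_le j hj z) ht j hj

/-- **The heat flow is a contraction of the Hölder modulus**: if `‖h x − h y‖ ≤ A‖x − y‖^α` for a
bounded continuous `h`, then the same holds for `e^{tΔ}h`, `0 < t` (the kernel is a probability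
density: `e^{tΔ}h(x) − e^{tΔ}h(y) = ∫ G_t(z) (h(x − z) − h(y − z)) dz`). [folklore] -/
theorem norm_heatExtension_sub_heatExtension_le_of_holder {G : Type*} [NormedAddCommGroup G]
    [NormedSpace ℝ G] [CompleteSpace G] {h : E → G} (hc : Continuous h) {C : ℝ}
    (hC : ∀ z, ‖h z‖ ≤ C) {A α : ℝ} (hH : ∀ x y, ‖h x - h y‖ ≤ A * ‖x - y‖ ^ α) {t : ℝ}
    (ht : 0 < t) (x y : E) :
    ‖heatExtension h t x - heatExtension h t y‖ ≤ A * ‖x - y‖ ^ α := by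
  have hix := UnboundedOperators.integrable_heatKernel_smul_of_bound hc hC ht x
  have hiy := UnboundedOperators.integrable_heatKernel_smul_of_bound hc hC ht y
  rw [UnboundedOperators.heatExtension_apply, UnboundedOperators.heatExtension_apply,
    ← integral_sub hix hiy]
  have hK := UnboundedOperators.integrable_heatKernel_holds (E := E) ht
  calc ‖∫ z, (heatKernel t z • h (x - z) - heatKernel t z • h (y - z))‖
      ≤ ∫ z, heatKernel t z * (A * ‖x - y‖ ^ α) := by
        refine norm_integral_le_of_norm_le (hK.mul_const _) (Eventually.of_forall fun z => ?_)
        rw [← smul_sub, norm_smul, Real.norm_of_nonneg (UnboundedOperators.heatKernel_pos ht z).le]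
        refine mul_le_mul_of_nonneg_left ?_ (UnboundedOperators.heatKernel_pos ht z).le
        have := hH (x - z) (y - z)
        rwa [show x - z - (y - z) = x - y by abel] at this
    _ = A * ‖x - y‖ ^ α := by
        rw [integral_mul_const, UnboundedOperators.integral_heatKernel_eq_one_holds ht, one_mul]

/-- **The free heat flow preserves `C^{k,α}` fields, with the same constant** (`0 < t`): the
slices are smooth, `‖Dʲe^{tΔ}a‖ ≤ ‖Dʲa‖_∞ ≤ A` (maximum principle for derivatives) and the Hölder
modulus of `Dᵏe^{tΔ}a = e^{tΔ}Dᵏa` is that of `Dᵏa`. This is the reason the bootstrap from a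
smooth datum loses nothing at the initial time. [folklore] -/
theorem IsHolderField.heatExtension (ha : IsHolderField k α A a) {t : ℝ} (ht : 0 < t) :
    IsHolderField k α A (UnboundedOperators.heatExtension a t) := by
  have hsm : ContDiff ℝ k (UnboundedOperators.heatExtension a t) :=
    contDiff_infty.1 (UnboundedOperators.contDiff_heatExtension_of_bound ha.continuous
      ha.norm_apply_le ht) k
  refine ⟨hsm, fun j hj x => ?_, fun x y => ?_⟩
  · exact UnboundedOperators.norm_iteratedFDeriv_heatExtension_le_of_bounded ha.contDiff
      (C := fun _ => A) (fun j hj z => ha.norm_le j hj z) ht hj x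
  · rw [ha.iteratedFDeriv_heatExtension ht le_rfl]
    have htop := ha.iteratedFDeriv_top
    exact norm_heatExtension_sub_heatExtension_le_of_holder htop.continuous htop.norm_apply_le
      htop.norm_sub_le ht x y

/-- Powers of `σ/2` and `σ/4` against powers of `σ`: `(σ/m)^e ≤ m^{3/2} σ^e` for `m ≥ 1` and
`-3/2 ≤ e ≤ 0`... in the crude form used below: `(σ / m) ^ e = m ^ (-e) * σ ^ e`. [folklore] -/
theorem div_rpow_eq_mul_rpow {σ m : ℝ} (hσ : 0 ≤ σ) (hm : 0 < m) (e : ℝ) :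
    (σ / m) ^ e = m ^ (-e) * σ ^ e := by
  rw [Real.div_rpow hσ hm.le, Real.rpow_neg hm.le, div_eq_mul_inv, mul_comm]

/-- **Hölder data gain derivatives under the heat flow, every order**: for every `k` there is
`C = C(k, E)` such that for `σ > 0`, `0 ≤ α ≤ 1` and a `C^{k,α}` field `a` with constant `A`,
`‖Dᵏ⁺¹e^{σΔ}a(x)‖ ≤ Cσ^{-1/2+α/2}A`, `‖Dᵏ⁺²e^{σΔ}a(x)‖ ≤ Cσ^{-1+α/2}A` and
`‖Dᵏ⁺³e^{σΔ}a(x)‖ ≤ Cσ^{-3/2+α/2}A`. Proof: `e^{σΔ}a = e^{(σ/4)Δ}e^{(σ/4)Δ}e^{(σ/2)Δ}a`; the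
innermost flow turns the `α`-Hölder top derivative `Dᵏa` into a bounded `Dᵏ⁺¹` of size
`cσ^{-1/2+α/2}A` (`exists_heatExtension_mollify_holder` applied to `Dᵏa`), and each of the two
outer flows gains one more bounded derivative at the price `2^{dim/2}(σ/4)^{-1/2}`
(`norm_iteratedFDeriv_succ_heatExtension_le_of_bounded`), the lower orders being preserved by the
maximum principle. (Ladyzhenskaya–Solonnikov–Ural'tseva 1968, Ch. IV §1, the kernel estimates
behind (2.1)–(2.2); Jia–Šverák 2014, Lemma 3.3.) [cite: JiaSverak2014, §3 Lemma 3.3 (heat-potential Hölder estimates)] -/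
theorem exists_holder_gain_heatExtension (k : ℕ) :
    ∃ C : ℝ, 0 ≤ C ∧ ∀ {σ α : ℝ}, 0 < σ → 0 ≤ α → α ≤ 1 → ∀ {a : E → F} {A : ℝ},
      IsHolderField k α A a → ∀ x,
        ‖iteratedFDeriv ℝ (k + 1) (heatExtension a σ) x‖ ≤ C * σ ^ (-(1 / 2 : ℝ) + α / 2) * A ∧
        ‖iteratedFDeriv ℝ (k + 2) (heatExtension a σ) x‖ ≤ C * σ ^ (-1 + α / 2) * A ∧
        ‖iteratedFDeriv ℝ (k + 3) (heatExtension a σ) x‖ ≤ C * σ ^ (-(3 / 2 : ℝ) + α / 2) * A := by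
  obtain ⟨c, hc, hmol⟩ := exists_heatExtension_mollify_holder (E := E) (F := E [×k]→L[ℝ] F)
  set d2 : ℝ := (2 : ℝ) ^ ((Module.finrank ℝ E : ℝ) / 2) with hd2
  have hd2p : 0 < d2 := by positivity
  -- the constant: `c 2^{1/2}` for the first bound, times `2 d2` for each further derivative
  refine ⟨c * 2 * (2 * d2) * (2 * d2), by positivity, fun {σ α} hσ hα0 hα1 {a A} ha x => ?_⟩
  have hA := ha.nonneg
  have hσ2 : 0 < σ / 2 := by positivity
  have hσ4 : 0 < σ / 4 := by positivity
  -- Step 1: `a₁ = e^{(σ/2)Δ}a` has `Dʲ` bounded by `A` (`j ≤ k`) and `Dᵏ⁺¹` bounded by `P`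
  set a₁ : E → F := heatExtension a (σ / 2) with ha₁
  set P : ℝ := c * (σ / 2) ^ (-(1 / 2 : ℝ) + α / 2) * A with hP
  have hP0 : 0 ≤ P := by positivity
  have ha₁s : ContDiff ℝ ∞ a₁ :=
    UnboundedOperators.contDiff_heatExtension_of_bound ha.continuous ha.norm_apply_le hσ2
  have ha₁H : IsHolderField k α A a₁ := ha.heatExtension hσ2
  have ha₁top : ∀ z, ‖iteratedFDeriv ℝ (k + 1) a₁ z‖ ≤ P := fun z => by
    rw [← norm_fderiv_iteratedFDeriv, ha.iteratedFDeriv_heatExtension hσ2 le_rfl]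
    exact (hmol hσ2 hα0 hα1 ha.iteratedFDeriv_top).2.2.1 z
  set C₁ : ℕ → ℝ := fun j => if j ≤ k then A else P with hC₁
  have hC₁b : ∀ j ≤ k + 1, ∀ z, ‖iteratedFDeriv ℝ j a₁ z‖ ≤ C₁ j := by
    intro j hj z
    by_cases hjk : j ≤ k
    · simp only [hC₁, if_pos hjk]; exact ha₁H.norm_le j hjk z
    · obtain rfl : j = k + 1 := by omega
      simp only [hC₁, if_neg hjk]; exact ha₁top z
  have ha₁c : ContDiff ℝ (k + 1 : ℕ) a₁ := contDiff_infty.1 ha₁s (k + 1)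
  -- Step 2: `a₂ = e^{(σ/4)Δ}a₁` has moreover `Dᵏ⁺²` bounded by `Q`
  set a₂ : E → F := heatExtension a₁ (σ / 4) with ha₂
  set Q : ℝ := d2 * (σ / 4) ^ (-(1 / 2 : ℝ)) * P with hQ
  have hQ0 : 0 ≤ Q := by positivity
  have ha₂s : ContDiff ℝ ∞ a₂ :=
    UnboundedOperators.contDiff_heatExtension_of_bound ha₁H.continuous ha₁H.norm_apply_le hσ4
  have ha₂low : ∀ j ≤ k + 1, ∀ z, ‖iteratedFDeriv ℝ j a₂ z‖ ≤ C₁ j := fun j hj z =>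
    UnboundedOperators.norm_iteratedFDeriv_heatExtension_le_of_bounded ha₁c hC₁b hσ4 hj z
  have ha₂top : ∀ z, ‖iteratedFDeriv ℝ (k + 2) a₂ z‖ ≤ Q := fun z => by
    have h := UnboundedOperators.norm_iteratedFDeriv_succ_heatExtension_le_of_bounded ha₁c hC₁b hσ4 z
    simp only [hC₁, if_neg (Nat.not_succ_le_self k)] at h
    exact h
  set C₂ : ℕ → ℝ := fun j => if j ≤ k + 1 then C₁ j else Q with hC₂
  have hC₂b : ∀ j ≤ k + 2, ∀ z, ‖iteratedFDeriv ℝ j a₂ z‖ ≤ C₂ j := by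
    intro j hj z
    by_cases hjk : j ≤ k + 1
    · simp only [hC₂, if_pos hjk]; exact ha₂low j hjk z
    · obtain rfl : j = k + 2 := by omega
      simp only [hC₂, if_neg hjk]; exact ha₂top z
  have ha₂c : ContDiff ℝ (k + 2 : ℕ) a₂ := contDiff_infty.1 ha₂s (k + 2)
  -- Step 3: `e^{σΔ}a = e^{(σ/4)Δ}a₂`
  have hsemi : heatExtension a σ = heatExtension a₂ (σ / 4) := by
    rw [ha₂, ha₁, UnboundedOperators.heatExtension_add_holds ha.memLp_top le_top hσ2 hσ4,
      UnboundedOperators.heatExtension_add_holds ha.memLp_top le_top (by positivity) hσ4]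
    congr 1; ring
  have hb1 : ‖iteratedFDeriv ℝ (k + 1) (heatExtension a σ) x‖ ≤ P := by
    rw [hsemi]
    have h := UnboundedOperators.norm_iteratedFDeriv_heatExtension_le_of_bounded ha₂c hC₂b hσ4
      (k := k + 1) (by omega) x
    simp only [hC₂, if_pos le_rfl, hC₁, if_neg (Nat.not_succ_le_self k)] at h
    exact h
  have hb2 : ‖iteratedFDeriv ℝ (k + 2) (heatExtension a σ) x‖ ≤ Q := by
    rw [hsemi]
    have h := UnboundedOperators.norm_iteratedFDeriv_heatExtension_le_of_bounded ha₂c hC₂b hσ4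
      (k := k + 2) le_rfl x
    simp only [hC₂, if_neg (by omega : ¬ (k + 2 ≤ k + 1))] at h
    exact h
  have hb3 : ‖iteratedFDeriv ℝ (k + 3) (heatExtension a σ) x‖ ≤ d2 * (σ / 4) ^ (-(1 / 2 : ℝ)) * Q := by
    rw [hsemi]
    have h := UnboundedOperators.norm_iteratedFDeriv_succ_heatExtension_le_of_bounded ha₂c hC₂b hσ4 x
    simp only [hC₂, if_neg (by omega : ¬ (k + 2 ≤ k + 1))] at h
    exact h
  -- bookkeeping of the powers of `σ`
  have hα' : 0 ≤ (1 / 2 : ℝ) - α / 2 ∧ (1 / 2 : ℝ) - α / 2 ≤ 1 / 2 := ⟨by linarith, by linarith⟩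
  have hpow2 : (2 : ℝ) ^ ((1 / 2 : ℝ) - α / 2) ≤ 2 := by
    calc (2 : ℝ) ^ ((1 / 2 : ℝ) - α / 2) ≤ 2 ^ (1 : ℝ) :=
          Real.rpow_le_rpow_of_exponent_le one_le_two (by linarith)
      _ = 2 := Real.rpow_one 2
  have hPle : P ≤ c * 2 * σ ^ (-(1 / 2 : ℝ) + α / 2) * A := by
    rw [hP, div_rpow_eq_mul_rpow hσ.le two_pos, show -(-(1 / 2 : ℝ) + α / 2) = 1 / 2 - α / 2 by ring]
    have : 0 ≤ σ ^ (-(1 / 2 : ℝ) + α / 2) * A := by positivity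
    calc c * (2 ^ ((1 / 2 : ℝ) - α / 2) * σ ^ (-(1 / 2 : ℝ) + α / 2)) * A
        = 2 ^ ((1 / 2 : ℝ) - α / 2) * (c * (σ ^ (-(1 / 2 : ℝ) + α / 2) * A)) := by ring
      _ ≤ 2 * (c * (σ ^ (-(1 / 2 : ℝ) + α / 2) * A)) := by gcongr
      _ = c * 2 * σ ^ (-(1 / 2 : ℝ) + α / 2) * A := by ring
  have h4 : (σ / 4) ^ (-(1 / 2 : ℝ)) = 2 * σ ^ (-(1 / 2 : ℝ)) := by
    rw [div_rpow_eq_mul_rpow hσ.le (by norm_num : (0 : ℝ) < 4), neg_neg,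
      show (4 : ℝ) = 2 ^ (2 : ℝ) by norm_num, ← Real.rpow_mul zero_le_two]
    norm_num
  have hexp1 : σ ^ (-(1 / 2 : ℝ)) * σ ^ (-(1 / 2 : ℝ) + α / 2) = σ ^ (-1 + α / 2) := by
    rw [← Real.rpow_add hσ]; congr 1; ring
  have hexp2 : σ ^ (-(1 / 2 : ℝ)) * σ ^ (-1 + α / 2) = σ ^ (-(3 / 2 : ℝ) + α / 2) := by
    rw [← Real.rpow_add hσ]; congr 1; ring
  have hQle : Q ≤ c * 2 * (2 * d2) * σ ^ (-1 + α / 2) * A := by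
    rw [hQ, h4]
    have : 0 ≤ d2 * (2 * σ ^ (-(1 / 2 : ℝ))) := by positivity
    calc d2 * (2 * σ ^ (-(1 / 2 : ℝ))) * P ≤ d2 * (2 * σ ^ (-(1 / 2 : ℝ))) *
          (c * 2 * σ ^ (-(1 / 2 : ℝ) + α / 2) * A) := mul_le_mul_of_nonneg_left hPle this
      _ = c * 2 * (2 * d2) * (σ ^ (-(1 / 2 : ℝ)) * σ ^ (-(1 / 2 : ℝ) + α / 2)) * A := by ring
      _ = c * 2 * (2 * d2) * σ ^ (-1 + α / 2) * A := by rw [hexp1]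
  have h3le : d2 * (σ / 4) ^ (-(1 / 2 : ℝ)) * Q ≤
      c * 2 * (2 * d2) * (2 * d2) * σ ^ (-(3 / 2 : ℝ) + α / 2) * A := by
    rw [h4]
    have : 0 ≤ d2 * (2 * σ ^ (-(1 / 2 : ℝ))) := by positivity
    calc d2 * (2 * σ ^ (-(1 / 2 : ℝ))) * Q ≤ d2 * (2 * σ ^ (-(1 / 2 : ℝ))) *
          (c * 2 * (2 * d2) * σ ^ (-1 + α / 2) * A) := mul_le_mul_of_nonneg_left hQle this
      _ = c * 2 * (2 * d2) * (2 * d2) * (σ ^ (-(1 / 2 : ℝ)) * σ ^ (-1 + α / 2)) * A := by ring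
      _ = c * 2 * (2 * d2) * (2 * d2) * σ ^ (-(3 / 2 : ℝ) + α / 2) * A := by rw [hexp2]
  -- the weaker constants are absorbed (`2 d2 ≥ 1`)
  have h2d2 : 1 ≤ 2 * d2 := by
    have : 1 ≤ d2 := Real.one_le_rpow one_le_two (by positivity)
    linarith
  refine ⟨hb1.trans (hPle.trans ?_), hb2.trans (hQle.trans ?_), hb3.trans h3le⟩
  · have h0 : 0 ≤ c * 2 * σ ^ (-(1 / 2 : ℝ) + α / 2) * A := by positivity
    calc c * 2 * σ ^ (-(1 / 2 : ℝ) + α / 2) * A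
        = 1 * 1 * (c * 2 * σ ^ (-(1 / 2 : ℝ) + α / 2) * A) := by ring
      _ ≤ (2 * d2) * (2 * d2) * (c * 2 * σ ^ (-(1 / 2 : ℝ) + α / 2) * A) := by
          gcongr
      _ = c * 2 * (2 * d2) * (2 * d2) * σ ^ (-(1 / 2 : ℝ) + α / 2) * A := by ring
  · have h0 : 0 ≤ c * 2 * (2 * d2) * σ ^ (-1 + α / 2) * A := by positivity
    calc c * 2 * (2 * d2) * σ ^ (-1 + α / 2) * A
        = 1 * (c * 2 * (2 * d2) * σ ^ (-1 + α / 2) * A) := by ring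
      _ ≤ (2 * d2) * (c * 2 * (2 * d2) * σ ^ (-1 + α / 2) * A) := by gcongr
      _ = c * 2 * (2 * d2) * (2 * d2) * σ ^ (-1 + α / 2) * A := by ring

end Heat

/-! ### The forward Duhamel integrals of the heat equation -/

section Duhamel

/-- The **forward Duhamel integral of the heat equation** from the base time `s`:
`heatDuhamel s g t x = ∫_{τ ∈ (s,t)} (e^{(t−τ)Δ} g(τ))(x) dτ`, the mild solution of
`∂ₜw − Δw = g`, `w(s) = 0` (Evans, *PDE*, §2.3.1 (13), Duhamel's principle), for time-dependent
data `g : ℝ → E → F` (a Bochner integral in `τ`, pointwise in `x`; junk where it diverges). [folklore] -/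
def heatDuhamel (s : ℝ) (g : ℝ → E → F) (t : ℝ) (x : E) : F :=
  ∫ τ in Ioo s t, heatExtension (g τ) (t - τ) x

/-- The **forward heat-gradient Duhamel integral** in the direction `v`:
`heatGradDuhamel s g v t x = ∫_{τ ∈ (s,t)} ∂ᵥ(e^{(t−τ)Δ} g(τ))(x) dτ`, the mild solution of
`∂ₜw − Δw = ∂ᵥg`, `w(s) = 0`, with the derivative carried by the kernel (the form in which the
divergence terms `−∂ⱼ(ζuⱼu)`, `−∂ᵢ(ζp)` of the localised Navier–Stokes equations enter;
Jia–Šverák 2014, proof of Thm. 3.2, the term `u₁`). [folklore] -/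
def heatGradDuhamel (s : ℝ) (g : ℝ → E → F) (v : E) (t : ℝ) (x : E) : F :=
  ∫ τ in Ioo s t, fderiv ℝ (heatExtension (g τ) (t - τ)) x v

/-- The Duhamel integrand `τ ↦ e^{(t−τ)Δ}g(τ)` on `(s, t)`, extended by `0` (so that every slice
is a smooth function of `x` when the data are bounded and continuous on `(s, t)`). [folklore] -/
def heatDuhamelIntegrand (g : ℝ → E → F) (s t : ℝ) : ℝ → E → F :=
  (Ioo s t).indicator fun τ => heatExtension (g τ) (t - τ)

variable {g : ℝ → E → F} {s t : ℝ}

omit [CompleteSpace F] in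
/-- On `(s, t)` the Duhamel integrand is the heat slice `e^{(t−τ)Δ}g(τ)`. [folklore] -/
theorem heatDuhamelIntegrand_of_mem {τ : ℝ} (hτ : τ ∈ Ioo s t) :
    heatDuhamelIntegrand g s t τ = heatExtension (g τ) (t - τ) :=
  indicator_of_mem hτ _

omit [CompleteSpace F] in
/-- Off `(s, t)` the Duhamel integrand vanishes. [folklore] -/
theorem heatDuhamelIntegrand_of_not_mem {τ : ℝ} (hτ : τ ∉ Ioo s t) :
    heatDuhamelIntegrand g s t τ = 0 :=
  indicator_of_notMem hτ _

omit [CompleteSpace F] in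
/-- `heatDuhamel` is the integral of the extended integrand. [folklore] -/
theorem heatDuhamel_eq_integral_heatDuhamelIntegrand (s : ℝ) (g : ℝ → E → F) (t : ℝ) (x : E) :
    heatDuhamel s g t x = ∫ τ in Ioo s t, heatDuhamelIntegrand g s t τ x := by
  rw [heatDuhamel]
  refine setIntegral_congr_fun measurableSet_Ioo fun τ hτ => ?_
  rw [heatDuhamelIntegrand_of_mem hτ]

omit [CompleteSpace F] in
/-- `heatGradDuhamel` is the integral of the directional derivative of the extended integrand. [folklore] -/
theorem heatGradDuhamel_eq_integral_fderiv_heatDuhamelIntegrand (s : ℝ) (g : ℝ → E → F) (v : E)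
    (t : ℝ) (x : E) :
    heatGradDuhamel s g v t x = ∫ τ in Ioo s t, fderiv ℝ (heatDuhamelIntegrand g s t τ) x v := by
  rw [heatGradDuhamel]
  refine setIntegral_congr_fun measurableSet_Ioo fun τ hτ => ?_
  rw [heatDuhamelIntegrand_of_mem hτ]

omit [FiniteDimensional ℝ E] in
/-- Measurability of the Gauss–Weierstrass kernel as a function of `(t, y)`. [folklore] -/
theorem measurable_uncurry_heatKernel : Measurable fun q : ℝ × E => heatKernel q.1 q.2 := by
  unfold UnboundedOperators.heatKernel
  fun_prop

omit [CompleteSpace F] in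
/-- **Joint measurability of the Duhamel integrand**: if `g` is jointly strongly measurable then
`(τ, x) ↦ heatDuhamelIntegrand g s t τ x` is strongly measurable (Fubini measurability of the
convolution integral, cut off by the indicator of `(s, t)`). [folklore] -/
theorem stronglyMeasurable_uncurry_heatDuhamelIntegrand (hg : StronglyMeasurable (uncurry g)) :
    StronglyMeasurable (uncurry (heatDuhamelIntegrand g s t)) := by
  have hS : MeasurableSet {q : ℝ × E | q.1 ∈ Ioo s t} := measurableSet_Ioo.preimage measurable_fst
  -- the un-cut-off convolution integral
  have hint : StronglyMeasurable
      (uncurry fun (q : ℝ × E) (y : E) => heatKernel (t - q.1) y • g q.1 (q.2 - y)) := by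
    have hK : Measurable fun r : (ℝ × E) × E => heatKernel (t - r.1.1) r.2 :=
      measurable_uncurry_heatKernel.comp ((measurable_const.sub measurable_fst.fst).prodMk measurable_snd)
    have hG : StronglyMeasurable fun r : (ℝ × E) × E => g r.1.1 (r.1.2 - r.2) :=
      hg.comp_measurable (measurable_fst.fst.prodMk (measurable_fst.snd.sub measurable_snd))
    exact hK.stronglyMeasurable.smul hG
  have hF : StronglyMeasurable fun q : ℝ × E => heatExtension (g q.1) (t - q.1) q.2 := by
    have h1 := hint.integral_prod_right' (ν := (volume : Measure E))
    have heq : (fun q : ℝ × E => heatExtension (g q.1) (t - q.1) q.2) =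
        fun q : ℝ × E => ∫ y, heatKernel (t - q.1) y • g q.1 (q.2 - y) := by
      funext q; rw [UnboundedOperators.heatExtension_apply]
    rw [heq]; exact h1
  have heq : uncurry (heatDuhamelIntegrand g s t) =
      {q : ℝ × E | q.1 ∈ Ioo s t}.piecewise (fun q : ℝ × E => heatExtension (g q.1) (t - q.1) q.2) 0 := by
    funext q
    by_cases hq : q.1 ∈ Ioo s t
    · rw [piecewise_eq_of_mem _ _ _ (show q ∈ {q : ℝ × E | q.1 ∈ Ioo s t} from hq)]
      show heatDuhamelIntegrand g s t q.1 q.2 = _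
      rw [heatDuhamelIntegrand_of_mem hq]
    · rw [piecewise_eq_of_notMem _ _ _ (show q ∉ {q : ℝ × E | q.1 ∈ Ioo s t} from hq)]
      show heatDuhamelIntegrand g s t q.1 q.2 = _
      rw [heatDuhamelIntegrand_of_not_mem hq]; rfl
  rw [heq]
  exact hF.piecewise hS stronglyMeasurable_const

/-- **Every slice of the Duhamel integrand is smooth** when the data are continuous and bounded
on `(s, t)`. [folklore] -/
theorem contDiff_heatDuhamelIntegrand {M : ℝ} (hc : ∀ τ ∈ Ioo s t, Continuous (g τ))
    (hM : ∀ τ ∈ Ioo s t, ∀ y, ‖g τ y‖ ≤ M) (τ : ℝ) :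
    ContDiff ℝ ∞ (heatDuhamelIntegrand g s t τ) := by
  by_cases hτ : τ ∈ Ioo s t
  · rw [heatDuhamelIntegrand_of_mem hτ]
    exact UnboundedOperators.contDiff_heatExtension_of_bound (hc τ hτ) (hM τ hτ) (sub_pos.2 hτ.2)
  · rw [heatDuhamelIntegrand_of_not_mem hτ]
    exact contDiff_const

omit [CompleteSpace F] in
/-- Bound transfer: a bound valid on `(s, t)` for the heat slice, and nonnegative everywhere,
bounds the derivatives of the Duhamel integrand everywhere. [folklore] -/
theorem norm_iteratedFDeriv_heatDuhamelIntegrand_le {i : ℕ} {B : ℝ → ℝ} (hB0 : ∀ τ, 0 ≤ B τ)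
    (hB : ∀ τ ∈ Ioo s t, ∀ x, ‖iteratedFDeriv ℝ i (heatExtension (g τ) (t - τ)) x‖ ≤ B τ)
    (τ : ℝ) (x : E) : ‖iteratedFDeriv ℝ i (heatDuhamelIntegrand g s t τ) x‖ ≤ B τ := by
  by_cases hτ : τ ∈ Ioo s t
  · rw [heatDuhamelIntegrand_of_mem hτ]; exact hB τ hτ x
  · rw [heatDuhamelIntegrand_of_not_mem hτ, iteratedFDeriv_zero, Pi.zero_apply, norm_zero]
    exact hB0 τ

omit [FiniteDimensional ℝ E] [MeasurableSpace E] [BorelSpace E] [CompleteSpace F] in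
/-- The directional derivative of the Duhamel integrand: the slices `x ↦ ∂ᵥ(N τ)(x)`. [folklore] -/
theorem contDiff_fderiv_apply_slice_of_contDiff {N : ℝ → E → F} (hN : ∀ τ, ContDiff ℝ ∞ (N τ)) (v : E)
    (τ : ℝ) : ContDiff ℝ ∞ (fun x => fderiv ℝ (N τ) x v) := by
  refine contDiff_infty.2 fun n => ?_
  have h : ContDiff ℝ (n + 1 : ℕ) (N τ) := contDiff_infty.1 (hN τ) (n + 1)
  exact (h.fderiv_right (m := n) le_rfl).clm_apply contDiff_const

omit [FiniteDimensional ℝ E] [MeasurableSpace E] [BorelSpace E] [CompleteSpace F] in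
/-- `‖Dⁱ(∂ᵥf)(x)‖ ≤ ‖v‖‖Dⁱ⁺¹f(x)‖` for a smooth `f`. [folklore] -/
theorem norm_iteratedFDeriv_fderiv_apply_le {f : E → F} (hf : ContDiff ℝ ∞ f) (v : E) (i : ℕ)
    (x : E) : ‖iteratedFDeriv ℝ i (fun y => fderiv ℝ f y v) x‖ ≤ ‖v‖ * ‖iteratedFDeriv ℝ (i + 1) f x‖ := by
  have h : ContDiff ℝ ∞ (fderiv ℝ f) := hf.fderiv_right (m := ∞) (by simp)
  calc ‖iteratedFDeriv ℝ i (fun y => fderiv ℝ f y v) x‖ ≤ ‖v‖ * ‖iteratedFDeriv ℝ i (fderiv ℝ f) x‖ :=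
        norm_iteratedFDeriv_clm_apply_const h.contDiffAt (by exact_mod_cast le_top)
    _ = ‖v‖ * ‖iteratedFDeriv ℝ (i + 1) f x‖ := by rw [norm_iteratedFDeriv_fderiv]

/-- `min 1 r ≤ r^{1/2}` for `r ≥ 0`. [folklore] -/
theorem min_one_le_rpow_half {r : ℝ} (hr : 0 ≤ r) : min 1 r ≤ r ^ (1 / 2 : ℝ) := by
  rcases le_or_gt r 1 with h | h
  · rw [min_eq_right h]
    conv_lhs => rw [← Real.rpow_one r]
    exact Real.rpow_le_rpow_of_exponent_ge' hr h (by norm_num) (by norm_num)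
  · rw [min_eq_left h.le]
    exact Real.one_le_rpow h.le (by norm_num)

/-- **The Duhamel integral of `C^{k,1/2}` data is `C^{k+1,1/2}`, uniformly up to the base
time**: for every `k` there is `C = C(k, E)` such that for `s < t ≤ s + 1`, jointly strongly
measurable `g` with `g(τ) ∈ C^{k,1/2}` (constant `A`) for `τ ∈ (s, t)`, the forward integral
`heatDuhamel s g t = ∫ₛᵗ e^{(t−τ)Δ}g(τ) dτ` is a `C^{k+1,1/2}` field with constant `C A`
(derivatives under the time integral: orders `≤ k` with the bound `A`, order `k + 1` with
`Gσ^{-1/4}A`, its Lipschitz modulus with `Gσ^{-3/4}A`, all integrable on `(s, t)`). The base time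
is part of the domain: no weight in `t − s` appears. [cite: JiaSverak2014, §3 Lemma 3.3 (2) and proof of Thm. 3.2 (the terms u₁, u₂), arXiv:1204.0529 p. 9] -/
theorem exists_heatDuhamel_holder_step (k : ℕ) :
    ∃ C : ℝ, 0 ≤ C ∧ ∀ {g : ℝ → E → F} {s t A : ℝ}, s < t → t ≤ s + 1 →
      StronglyMeasurable (uncurry g) → (∀ τ ∈ Ioo s t, IsHolderField k (1 / 2) A (g τ)) →
      IsHolderField (k + 1) (1 / 2) (C * A) (heatDuhamel s g t) := by
  obtain ⟨G, hG, hGain⟩ := exists_holder_gain_heatExtension (E := E) (F := F) k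
  refine ⟨1 + 4 * G, by positivity, fun {g s t A} hst hts hg hH => ?_⟩
  have hA : 0 ≤ A := (hH ((s + t) / 2) ⟨by linarith, by linarith⟩).nonneg
  have hts1 : t - s ≤ 1 := by linarith
  have hts0 : 0 < t - s := sub_pos.2 hst
  have hbdd : ∀ τ ∈ Ioo s t, ∀ y, ‖g τ y‖ ≤ A := fun τ hτ y => (hH τ hτ).norm_apply_le y
  have hcont : ∀ τ ∈ Ioo s t, Continuous (g τ) := fun τ hτ => (hH τ hτ).continuous
  -- clean exponents for the gain bounds at `α = 1/2`
  have hG1 : ∀ τ ∈ Ioo s t, ∀ x,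
      ‖iteratedFDeriv ℝ (k + 1) (heatExtension (g τ) (t - τ)) x‖ ≤ G * (t - τ) ^ (-(1 / 4 : ℝ)) * A :=
    fun τ hτ x => by
    have := (hGain (sub_pos.2 hτ.2) (by norm_num) (by norm_num) (hH τ hτ) x).1
    convert this using 3; norm_num
  have hG2 : ∀ τ ∈ Ioo s t, ∀ x,
      ‖iteratedFDeriv ℝ (k + 2) (heatExtension (g τ) (t - τ)) x‖ ≤ G * (t - τ) ^ (-(3 / 4 : ℝ)) * A :=
    fun τ hτ x => by
    have := (hGain (sub_pos.2 hτ.2) (by norm_num) (by norm_num) (hH τ hτ) x).2.1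
    convert this using 3; norm_num
  -- the dominated-differentiation package at order `k + 1`
  set Nd := heatDuhamelIntegrand g s t with hNd
  have hmeas := stronglyMeasurable_uncurry_heatDuhamelIntegrand (s := s) (t := t) hg
  have hsmooth := contDiff_heatDuhamelIntegrand (s := s) (t := t) hcont hbdd
  set bound : ℕ → ℝ → ℝ := fun i τ => if i ≤ k then A else G * A * ‖(t - τ) ^ (-(1 / 4 : ℝ))‖
    with hbound
  obtain ⟨hI, hIval⟩ := integral_Ioo_norm_sub_rpow (s := s) (t := t) (e := -(1 / 4 : ℝ)) hst (by norm_num)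
  obtain ⟨hJ, hJval⟩ := integral_Ioo_norm_sub_rpow (s := s) (t := t) (e := -(3 / 4 : ℝ)) hst (by norm_num)
  have hbi : ∀ i ≤ k + 1, Integrable (bound i) (volume.restrict (Ioo s t)) := by
    intro i _
    by_cases hik : i ≤ k
    · simp only [hbound, if_pos hik]; exact integrableOn_const (measure_Ioo_lt_top.ne)
    · simp only [hbound, if_neg hik]; exact hI.const_mul _
  have hb : ∀ i ≤ k + 1, ∀ τ x, ‖iteratedFDeriv ℝ i (Nd τ) x‖ ≤ bound i τ := by
    intro i hi τ x
    by_cases hik : i ≤ k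
    · simp only [hbound, if_pos hik]
      exact norm_iteratedFDeriv_heatDuhamelIntegrand_le (B := fun _ => A) (fun _ => hA)
        (fun τ hτ x => ((hH τ hτ).heatExtension (sub_pos.2 hτ.2)).norm_le i hik x) τ x
    · obtain rfl : i = k + 1 := by omega
      simp only [hbound, if_neg hik]
      refine norm_iteratedFDeriv_heatDuhamelIntegrand_le
        (B := fun τ => G * A * ‖(t - τ) ^ (-(1 / 4 : ℝ))‖) (fun τ => by positivity) (fun τ hτ x => ?_) τ x
      calc ‖iteratedFDeriv ℝ (k + 1) (heatExtension (g τ) (t - τ)) x‖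
          ≤ G * (t - τ) ^ (-(1 / 4 : ℝ)) * A := hG1 τ hτ x
        _ = G * A * (t - τ) ^ (-(1 / 4 : ℝ)) := by ring
        _ ≤ G * A * ‖(t - τ) ^ (-(1 / 4 : ℝ))‖ := by gcongr; exact Real.le_norm_self _
  have hpack := contDiff_integral_of_dominated_iteratedFDeriv (m := k + 1) hmeas hsmooth hbi hb
  have hfun : heatDuhamel s g t = fun x => ∫ τ in Ioo s t, Nd τ x :=
    funext fun x => heatDuhamel_eq_integral_heatDuhamelIntegrand s g t x
  rw [hfun]
  have hnk : ¬ (k + 1 ≤ k) := Nat.not_succ_le_self k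
  -- sup bound at the top order
  have htop : ∀ x, ‖iteratedFDeriv ℝ (k + 1) (fun x => ∫ τ in Ioo s t, Nd τ x) x‖ ≤ 2 * G * A := by
    intro x
    have h := norm_iteratedFDeriv_integral_le hmeas hsmooth hbi hb (j := k + 1) le_rfl x
    refine h.trans ?_
    simp only [hbound, if_neg hnk]
    rw [MeasureTheory.integral_const_mul, hIval]
    norm_num
    have h34 : (t - s) ^ (3 / 4 : ℝ) ≤ 1 := Real.rpow_le_one hts0.le hts1 (by norm_num)
    have : 0 ≤ G * A := by positivity
    calc G * A * ((t - s) ^ (3 / 4 : ℝ) / (3 / 4)) = (4 / 3) * (G * A) * (t - s) ^ (3 / 4 : ℝ) := by ring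
      _ ≤ (4 / 3) * (G * A) * 1 := by gcongr
      _ ≤ 2 * G * A := by nlinarith
  refine ⟨hpack.1, fun j hj x => ?_, fun x y => ?_⟩
  · by_cases hjk : j ≤ k
    · have h := norm_iteratedFDeriv_integral_le hmeas hsmooth hbi hb (j := j) hj x
      refine h.trans ?_
      simp only [hbound, if_pos hjk]
      rw [setIntegral_const, smul_eq_mul, Real.volume_real_Ioo_of_le hst.le]
      have : 0 ≤ 4 * G * A := by positivity
      nlinarith
    · obtain rfl : j = k + 1 := by omega
      refine (htop x).trans ?_
      nlinarith
  · -- Hölder modulus of the top derivative: min of the oscillation and the Lipschitz bounds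
    set r : ℝ := ‖x - y‖ with hr
    have hr0 : 0 ≤ r := norm_nonneg _
    have h1 : ‖iteratedFDeriv ℝ (k + 1) (fun x => ∫ τ in Ioo s t, Nd τ x) x -
        iteratedFDeriv ℝ (k + 1) (fun x => ∫ τ in Ioo s t, Nd τ x) y‖ ≤ 4 * G * A :=
      (norm_sub_le _ _).trans (by linarith [htop x, htop y])
    set c : ℝ → ℝ := fun τ => G * A * r * ‖(t - τ) ^ (-(3 / 4 : ℝ))‖ with hc
    have hci : Integrable c (volume.restrict (Ioo s t)) := hJ.const_mul _
    have hcb : ∀ τ, ‖iteratedFDeriv ℝ (k + 1) (Nd τ) x - iteratedFDeriv ℝ (k + 1) (Nd τ) y‖ ≤ c τ := by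
      intro τ
      by_cases hτ : τ ∈ Ioo s t
      · have hσ : 0 < t - τ := sub_pos.2 hτ.2
        simp only [hNd, heatDuhamelIntegrand_of_mem hτ]
        have hsm : ContDiff ℝ (k + 1 + 1 : ℕ) (heatExtension (g τ) (t - τ)) :=
          contDiff_infty.1 (UnboundedOperators.contDiff_heatExtension_of_bound (hcont τ hτ)
            (hbdd τ hτ) hσ) _
        have h2 := norm_iteratedFDeriv_sub_le_of_bound hsm (hG2 τ hτ) x y
        refine h2.trans (le_of_eq ?_)
        simp only [hc]
        rw [Real.norm_of_nonneg (Real.rpow_nonneg hσ.le _), ← hr]; ring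
      · simp only [hNd, heatDuhamelIntegrand_of_not_mem hτ, iteratedFDeriv_zero, Pi.zero_apply,
          sub_self, norm_zero]
        positivity
    have h2 : ‖iteratedFDeriv ℝ (k + 1) (fun x => ∫ τ in Ioo s t, Nd τ x) x -
        iteratedFDeriv ℝ (k + 1) (fun x => ∫ τ in Ioo s t, Nd τ x) y‖ ≤ 4 * G * A * r := by
      have h := norm_iteratedFDeriv_integral_sub_le hmeas hsmooth hbi hb (j := k + 1) le_rfl hci hcb
      refine h.trans ?_
      simp only [hc]
      rw [MeasureTheory.integral_const_mul, hJval]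
      norm_num
      have h14 : (t - s) ^ (1 / 4 : ℝ) ≤ 1 := Real.rpow_le_one hts0.le hts1 (by norm_num)
      have : 0 ≤ G * A * r := by positivity
      calc G * A * r * ((t - s) ^ (1 / 4 : ℝ) / (1 / 4)) = 4 * (G * A * r) * (t - s) ^ (1 / 4 : ℝ) := by
            ring
        _ ≤ 4 * (G * A * r) * 1 := by gcongr
        _ = 4 * G * A * r := by ring
    have hmin : ‖iteratedFDeriv ℝ (k + 1) (fun x => ∫ τ in Ioo s t, Nd τ x) x -
        iteratedFDeriv ℝ (k + 1) (fun x => ∫ τ in Ioo s t, Nd τ x) y‖ ≤ 4 * G * A * min 1 r := by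
      rcases le_total 1 r with h1r | hr1
      · rw [min_eq_left h1r, mul_one]; exact h1
      · rw [min_eq_right hr1]; exact h2
    refine hmin.trans ?_
    have hGA : 0 ≤ 4 * G * A := by positivity
    calc 4 * G * A * min 1 r ≤ 4 * G * A * r ^ (1 / 2 : ℝ) :=
          mul_le_mul_of_nonneg_left (min_one_le_rpow_half hr0) hGA
      _ ≤ (1 + 4 * G) * A * r ^ (1 / 2 : ℝ) := by
          have : 0 ≤ A * r ^ (1 / 2 : ℝ) := by positivity
          nlinarith

/-- **The heat-gradient Duhamel integral of `C^{k,1/2}` data is `C^{k+1,1/2}`, uniformly up to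
the base time** (the gain of one derivative that drives the bootstrap): for every `k` there is
`C = C(k, E)` such that for `s < t ≤ s + 1`, `‖v‖ ≤ 1`, jointly strongly measurable `g` with
`g(τ) ∈ C^{k,1/2}` (constant `A`) for `τ ∈ (s, t)`, the forward integral
`heatGradDuhamel s g v t = ∫ₛᵗ ∂ᵥe^{(t−τ)Δ}g(τ) dτ` is a `C^{k+1,1/2}` field with constant `C A`
(orders `≤ k` under the bound `A + Gσ^{-1/4}A`, order `k + 1` under `Gσ^{-3/4}A`, and the Hölder
modulus of order `k + 1` by the lossless splitting `∫ min(2σ^{-3/4}, rσ^{-5/4}) ≤ 12 r^{1/2}`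
against the bound `Gσ^{-5/4}A` of order `k + 2`). [cite: JiaSverak2014, §3 Lemma 3.3 (2) and proof of Thm. 3.2 (the term u₁), arXiv:1204.0529 p. 9] -/
theorem exists_heatGradDuhamel_holder_step (k : ℕ) :
    ∃ C : ℝ, 0 ≤ C ∧ ∀ {g : ℝ → E → F} {s t A : ℝ} {v : E}, s < t → t ≤ s + 1 → ‖v‖ ≤ 1 →
      StronglyMeasurable (uncurry g) → (∀ τ ∈ Ioo s t, IsHolderField k (1 / 2) A (g τ)) →
      IsHolderField (k + 1) (1 / 2) (C * A) (heatGradDuhamel s g v t) := by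
  obtain ⟨G, hG, hGain⟩ := exists_holder_gain_heatExtension (E := E) (F := F) k
  refine ⟨1 + 12 * G, by positivity, fun {g s t A v} hst hts hv hg hH => ?_⟩
  have hA : 0 ≤ A := (hH ((s + t) / 2) ⟨by linarith, by linarith⟩).nonneg
  have hts1 : t - s ≤ 1 := by linarith
  have hts0 : 0 < t - s := sub_pos.2 hst
  have hv0 : 0 ≤ ‖v‖ := norm_nonneg v
  have hbdd : ∀ τ ∈ Ioo s t, ∀ y, ‖g τ y‖ ≤ A := fun τ hτ y => (hH τ hτ).norm_apply_le y
  have hcont : ∀ τ ∈ Ioo s t, Continuous (g τ) := fun τ hτ => (hH τ hτ).continuous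
  have hsmS : ∀ τ ∈ Ioo s t, ContDiff ℝ ∞ (heatExtension (g τ) (t - τ)) := fun τ hτ =>
    UnboundedOperators.contDiff_heatExtension_of_bound (hcont τ hτ) (hbdd τ hτ) (sub_pos.2 hτ.2)
  -- clean exponents for the gain bounds at `α = 1/2`
  have hG1 : ∀ τ ∈ Ioo s t, ∀ x,
      ‖iteratedFDeriv ℝ (k + 1) (heatExtension (g τ) (t - τ)) x‖ ≤ G * (t - τ) ^ (-(1 / 4 : ℝ)) * A :=
    fun τ hτ x => by
    have := (hGain (sub_pos.2 hτ.2) (by norm_num) (by norm_num) (hH τ hτ) x).1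
    convert this using 3; norm_num
  have hG2 : ∀ τ ∈ Ioo s t, ∀ x,
      ‖iteratedFDeriv ℝ (k + 2) (heatExtension (g τ) (t - τ)) x‖ ≤ G * (t - τ) ^ (-(3 / 4 : ℝ)) * A :=
    fun τ hτ x => by
    have := (hGain (sub_pos.2 hτ.2) (by norm_num) (by norm_num) (hH τ hτ) x).2.1
    convert this using 3; norm_num
  have hG3 : ∀ τ ∈ Ioo s t, ∀ x,
      ‖iteratedFDeriv ℝ (k + 3) (heatExtension (g τ) (t - τ)) x‖ ≤ G * (t - τ) ^ (-(5 / 4 : ℝ)) * A :=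
    fun τ hτ x => by
    have := (hGain (sub_pos.2 hτ.2) (by norm_num) (by norm_num) (hH τ hτ) x).2.2
    convert this using 3; norm_num
  -- the integrand `N τ x = ∂ᵥ(heatDuhamelIntegrand τ)(x)` and its package at order `k + 1`
  set Nd := heatDuhamelIntegrand g s t with hNd
  set N : ℝ → E → F := fun τ x => fderiv ℝ (Nd τ) x v with hN
  have hmeasNd := stronglyMeasurable_uncurry_heatDuhamelIntegrand (s := s) (t := t) hg
  have hsmoothNd := contDiff_heatDuhamelIntegrand (s := s) (t := t) hcont hbdd
  have hmeas : StronglyMeasurable (uncurry N) :=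
    stronglyMeasurable_fderiv_apply_param hmeasNd
      (fun τ x => ((hsmoothNd τ).differentiable (by simp)).differentiableAt) v
  have hsmooth : ∀ τ, ContDiff ℝ ∞ (N τ) := contDiff_fderiv_apply_slice_of_contDiff hsmoothNd v
  -- derivatives of `N τ` against derivatives of the heat slice
  have hNder : ∀ τ ∈ Ioo s t, ∀ i x, ‖iteratedFDeriv ℝ i (N τ) x‖ ≤
      ‖iteratedFDeriv ℝ (i + 1) (heatExtension (g τ) (t - τ)) x‖ := fun τ hτ i x => by
    simp only [hN, hNd, heatDuhamelIntegrand_of_mem hτ]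
    calc ‖iteratedFDeriv ℝ i (fun x => fderiv ℝ (heatExtension (g τ) (t - τ)) x v) x‖
        ≤ ‖v‖ * ‖iteratedFDeriv ℝ (i + 1) (heatExtension (g τ) (t - τ)) x‖ :=
          norm_iteratedFDeriv_fderiv_apply_le (hsmS τ hτ) v i x
      _ ≤ 1 * ‖iteratedFDeriv ℝ (i + 1) (heatExtension (g τ) (t - τ)) x‖ := by gcongr
      _ = _ := one_mul _
  have hNzero : ∀ τ, τ ∉ Ioo s t → ∀ i x, iteratedFDeriv ℝ i (N τ) x = 0 := fun τ hτ i x => by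
    have : N τ = 0 := by
      funext y; simp only [hN, hNd, heatDuhamelIntegrand_of_not_mem hτ, fderiv_zero]; rfl
    rw [this, iteratedFDeriv_zero]; rfl
  set bound : ℕ → ℝ → ℝ := fun i τ =>
    if i ≤ k then A + G * A * ‖(t - τ) ^ (-(1 / 4 : ℝ))‖ else G * A * ‖(t - τ) ^ (-(3 / 4 : ℝ))‖
    with hbound
  obtain ⟨hI, hIval⟩ := integral_Ioo_norm_sub_rpow (s := s) (t := t) (e := -(1 / 4 : ℝ)) hst (by norm_num)
  obtain ⟨hJ, hJval⟩ := integral_Ioo_norm_sub_rpow (s := s) (t := t) (e := -(3 / 4 : ℝ)) hst (by norm_num)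
  have hconst : Integrable (fun _ : ℝ => A) (volume.restrict (Ioo s t)) :=
    integrableOn_const (measure_Ioo_lt_top.ne)
  have hbi : ∀ i ≤ k + 1, Integrable (bound i) (volume.restrict (Ioo s t)) := by
    intro i _
    by_cases hik : i ≤ k
    · simp only [hbound, if_pos hik]
      exact hconst.add (hI.const_mul _)
    · simp only [hbound, if_neg hik]; exact hJ.const_mul _
  have hb : ∀ i ≤ k + 1, ∀ τ x, ‖iteratedFDeriv ℝ i (N τ) x‖ ≤ bound i τ := by
    intro i hi τ x
    by_cases hτ : τ ∈ Ioo s t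
    · have hσ : 0 < t - τ := sub_pos.2 hτ.2
      refine (hNder τ hτ i x).trans ?_
      by_cases hik : i ≤ k
      · simp only [hbound, if_pos hik]
        rcases Nat.lt_or_ge i k with hlt | hge
        · -- `i + 1 ≤ k`: maximum principle
          have h := ((hH τ hτ).heatExtension hσ).norm_le (i + 1) hlt x
          have : 0 ≤ G * A * ‖(t - τ) ^ (-(1 / 4 : ℝ))‖ := by positivity
          linarith
        · obtain rfl : i = k := le_antisymm hik hge
          calc ‖iteratedFDeriv ℝ (i + 1) (heatExtension (g τ) (t - τ)) x‖
              ≤ G * (t - τ) ^ (-(1 / 4 : ℝ)) * A := hG1 τ hτ x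
            _ = G * A * (t - τ) ^ (-(1 / 4 : ℝ)) := by ring
            _ ≤ G * A * ‖(t - τ) ^ (-(1 / 4 : ℝ))‖ := by gcongr; exact Real.le_norm_self _
            _ ≤ A + G * A * ‖(t - τ) ^ (-(1 / 4 : ℝ))‖ := by linarith
      · obtain rfl : i = k + 1 := by omega
        simp only [hbound, if_neg hik]
        calc ‖iteratedFDeriv ℝ (k + 1 + 1) (heatExtension (g τ) (t - τ)) x‖
            ≤ G * (t - τ) ^ (-(3 / 4 : ℝ)) * A := hG2 τ hτ x
          _ = G * A * (t - τ) ^ (-(3 / 4 : ℝ)) := by ring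
          _ ≤ G * A * ‖(t - τ) ^ (-(3 / 4 : ℝ))‖ := by gcongr; exact Real.le_norm_self _
    · rw [hNzero τ hτ i x, norm_zero]
      by_cases hik : i ≤ k
      · simp only [hbound, if_pos hik]; positivity
      · simp only [hbound, if_neg hik]; positivity
  have hpack := contDiff_integral_of_dominated_iteratedFDeriv (m := k + 1) hmeas hsmooth hbi hb
  have hfun : heatGradDuhamel s g v t = fun x => ∫ τ in Ioo s t, N τ x :=
    funext fun x => heatGradDuhamel_eq_integral_fderiv_heatDuhamelIntegrand s g v t x
  rw [hfun]
  have hnk : ¬ (k + 1 ≤ k) := Nat.not_succ_le_self k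
  have h34 : (t - s) ^ (3 / 4 : ℝ) ≤ 1 := Real.rpow_le_one hts0.le hts1 (by norm_num)
  have h14 : (t - s) ^ (1 / 4 : ℝ) ≤ 1 := Real.rpow_le_one hts0.le hts1 (by norm_num)
  refine ⟨hpack.1, fun j hj x => ?_, fun x y => ?_⟩
  · by_cases hjk : j ≤ k
    · have h := norm_iteratedFDeriv_integral_le hmeas hsmooth hbi hb (j := j) hj x
      refine h.trans ?_
      simp only [hbound, if_pos hjk]
      rw [integral_add hconst (hI.const_mul _),
        setIntegral_const, smul_eq_mul, Real.volume_real_Ioo_of_le hst.le,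
        MeasureTheory.integral_const_mul, hIval]
      norm_num
      have : 0 ≤ G * A := by positivity
      calc (t - s) * A + G * A * ((t - s) ^ (3 / 4 : ℝ) / (3 / 4))
          = (t - s) * A + (4 / 3) * (G * A) * (t - s) ^ (3 / 4 : ℝ) := by ring
        _ ≤ 1 * A + (4 / 3) * (G * A) * 1 := by gcongr
        _ ≤ (1 + 12 * G) * A := by nlinarith
    · obtain rfl : j = k + 1 := by omega
      have h := norm_iteratedFDeriv_integral_le hmeas hsmooth hbi hb (j := k + 1) le_rfl x
      refine h.trans ?_
      simp only [hbound, if_neg hnk]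
      rw [MeasureTheory.integral_const_mul, hJval]
      norm_num
      have : 0 ≤ G * A := by positivity
      calc G * A * ((t - s) ^ (1 / 4 : ℝ) / (1 / 4)) = 4 * (G * A) * (t - s) ^ (1 / 4 : ℝ) := by ring
        _ ≤ 4 * (G * A) * 1 := by gcongr
        _ ≤ (1 + 12 * G) * A := by nlinarith
  · -- Hölder modulus of the top derivative: the lossless splitting
    set r : ℝ := ‖x - y‖ with hr
    have hr0 : 0 ≤ r := norm_nonneg _
    rcases hr0.eq_or_lt with hrz | hrp
    · have hxy : x = y := by rwa [hr, eq_comm, norm_sub_eq_zero_iff] at hrz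
      rw [hxy, sub_self, norm_zero]; positivity
    obtain ⟨hKint, hKval⟩ := integral_Ioo_min_rpow_le hst hrp
    set c : ℝ → ℝ := fun τ =>
      G * A * ‖min (2 * (t - τ) ^ (-(3 / 4 : ℝ))) (r * (t - τ) ^ (-(5 / 4 : ℝ)))‖ with hc
    have hci : Integrable c (volume.restrict (Ioo s t)) := hKint.norm.const_mul _
    have hcb : ∀ τ, ‖iteratedFDeriv ℝ (k + 1) (N τ) x - iteratedFDeriv ℝ (k + 1) (N τ) y‖ ≤ c τ := by
      intro τ
      by_cases hτ : τ ∈ Ioo s t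
      · have hσ : 0 < t - τ := sub_pos.2 hτ.2
        set σ := t - τ with hσdef
        have h1 : ‖iteratedFDeriv ℝ (k + 1) (N τ) x - iteratedFDeriv ℝ (k + 1) (N τ) y‖ ≤
            2 * (G * σ ^ (-(3 / 4 : ℝ)) * A) :=
          (norm_sub_le _ _).trans (by
            linarith [(hNder τ hτ (k + 1) x).trans (hG2 τ hτ x), (hNder τ hτ (k + 1) y).trans (hG2 τ hτ y)])
        have hN2 : ∀ z, ‖iteratedFDeriv ℝ (k + 1 + 1) (N τ) z‖ ≤ G * σ ^ (-(5 / 4 : ℝ)) * A :=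
          fun z => (hNder τ hτ (k + 2) z).trans (hG3 τ hτ z)
        have h2 : ‖iteratedFDeriv ℝ (k + 1) (N τ) x - iteratedFDeriv ℝ (k + 1) (N τ) y‖ ≤
            (G * σ ^ (-(5 / 4 : ℝ)) * A) * r :=
          norm_iteratedFDeriv_sub_le_of_bound (contDiff_infty.1 (hsmooth τ) _) hN2 x y
        refine (le_min h1 h2).trans ?_
        simp only [hc]
        have hGA : 0 ≤ G * A := by positivity
        calc min (2 * (G * σ ^ (-(3 / 4 : ℝ)) * A)) (G * σ ^ (-(5 / 4 : ℝ)) * A * r)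
            = G * A * min (2 * σ ^ (-(3 / 4 : ℝ))) (r * σ ^ (-(5 / 4 : ℝ))) := by
              rw [mul_min_of_nonneg _ _ hGA]; congr 1 <;> ring
          _ ≤ G * A * ‖min (2 * σ ^ (-(3 / 4 : ℝ))) (r * σ ^ (-(5 / 4 : ℝ)))‖ := by
              gcongr; exact Real.le_norm_self _
      · rw [hNzero τ hτ, hNzero τ hτ, sub_self, norm_zero]
        positivity
    have h := norm_iteratedFDeriv_integral_sub_le hmeas hsmooth hbi hb (j := k + 1) le_rfl hci hcb
    refine h.trans ?_
    simp only [hc]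
    rw [MeasureTheory.integral_const_mul]
    have hnorm : ∫ τ in Ioo s t, ‖min (2 * (t - τ) ^ (-(3 / 4 : ℝ))) (r * (t - τ) ^ (-(5 / 4 : ℝ)))‖ =
        ∫ τ in Ioo s t, min (2 * (t - τ) ^ (-(3 / 4 : ℝ))) (r * (t - τ) ^ (-(5 / 4 : ℝ))) := by
      refine setIntegral_congr_fun measurableSet_Ioo fun τ hτ => Real.norm_of_nonneg ?_
      have : 0 < t - τ := sub_pos.2 hτ.2
      exact le_min (by positivity) (by positivity)
    rw [hnorm]
    have : 0 ≤ A * r ^ (1 / 2 : ℝ) := by positivity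
    calc G * A * ∫ τ in Ioo s t, min (2 * (t - τ) ^ (-(3 / 4 : ℝ))) (r * (t - τ) ^ (-(5 / 4 : ℝ)))
        ≤ G * A * (12 * r ^ (1 / 2 : ℝ)) := by gcongr
      _ = 12 * G * (A * r ^ (1 / 2 : ℝ)) := by ring
      _ ≤ (1 + 12 * G) * (A * r ^ (1 / 2 : ℝ)) := by gcongr; linarith
      _ = (1 + 12 * G) * A * r ^ (1 / 2 : ℝ) := by ring

end Duhamel

end Literature.Analysis.FluidPDE

end
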